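import Literature.Geometry.DiscreteGeometry.ShellCensusSearchPhaseTwo
import HarnessLib

/-!
# Soundness of the census growth search, part D2: dead stars, the final test, the Phase-2 driver

Topic `Literature/Geometry/DiscreteGeometry`.  Soundness of the certified dead-star predicates,
of the recogniser and the final test, and of the Phase-2 driver `assign` / `bondPhase`.
-/

namespace Literature.Geometry.DiscreteGeometry

namespace ShellCensusSearch

open Finset

/-! ### The certified dead stars -/

namespace RealizesB

variable {M : CF} {φ : ℕ → Fin 12} {s : St}

/-- Image of a sorted code of three distinct labels. [folklore] -/
theorem tset_sortTri12 {a b c : ℕ} (ha : a < 12) (hb : b < 12) (hc : c < 12) (hab : a ≠ b) (hbc : b ≠ c)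
    (hac : a ≠ c) : tset φ (sortTri a b c) = {φ a, φ b, φ c} := by
  obtain ⟨-, hl⟩ := sortTri_spec ha hb hc (by norm_num) hab hbc hac
  rw [tset, hl]; simp [image_insert]

/-- The star of `φ v` read off a certified `starIs`. [folklore] -/
theorem star_of_starIs (h : RealizesB M φ s) {v : ℕ} (hv : v < 12) {T : List ℕ} (hT : s.starIs v T = true) :
    M.star (φ v) = (T.map (tset φ)).toFinset := by
  ext S
  rw [h.mem_star_iff hv, List.mem_toFinset, List.mem_map]
  constructor
  · rintro ⟨t, ht, rfl⟩; exact ⟨t, (starIs_spec hT t).1 ht, rfl⟩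
  · rintro ⟨t, ht, rfl⟩; exact ⟨t, (starIs_spec hT t).2 ht, rfl⟩

/-- **Certified `4T` is a contradiction.** [folklore] -/
theorem kill4T_sound (h : RealizesB M φ s) {v a b c d : ℕ} (hk : s.kill4T v a b c d = true) : False := by
  unfold St.kill4T at hk
  simp only [Bool.and_eq_true, beq_iff_eq, and_assoc] at hk
  obtain ⟨hdist, -, hstar, fva, fvb, fvc, fvd, fab, fbc, fcd, fda⟩ := hk
  obtain ⟨hlt, hnd⟩ := distinctLt_spec hdist
  have hv := hlt v (by simp); have ha := hlt a (by simp); have hb := hlt b (by simp)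
  have hc := hlt c (by simp); have hd := hlt d (by simp)
  simp only [List.nodup_cons, List.mem_cons, not_or, List.not_mem_nil, not_false_eq_true,
    and_true, List.nodup_nil] at hnd
  obtain ⟨⟨hva, hvb, hvc, hvd⟩, ⟨hab, hac, had⟩, ⟨hbc, hbd⟩, hcd⟩ := hnd
  have B := fun x y (hx : x < 12) (hy : y < 12) (hxy : x ≠ y) (hf : s.ggb x y = 2) => h.flag2 x y hx hy hxy hf
  refine M.noFourT (φ v) (φ a) (φ b) (φ c) (φ d) ?_ (B v a hv ha hva fva) (B v b hv hb hvb fvb) (B v c hv hc hvc fvc)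
    (B v d hv hd hvd fvd) (B a b ha hb hab fab) (B b c hb hc hbc fbc) (B c d hc hd hcd fcd) (B d a hd ha (Ne.symm had) fda)
  show M.star (φ v) = _
  rw [h.star_of_starIs hv hstar]
  simp only [List.map_cons, List.map_nil, List.toFinset_cons, List.toFinset_nil, insert_empty_eq]
  rw [tset_sortTri12 hv ha hb hva hab hvb, tset_sortTri12 hv hb hc hvb hbc hvc, tset_sortTri12 hv hc hd hvc hcd hvd,
    tset_sortTri12 hv hd ha hvd (Ne.symm had) hva]

/-- **Certified `3T+Q` is a contradiction.** [folklore] -/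
theorem kill3TQ_sound (h : RealizesB M φ s) {v a b c d x : ℕ} (hk : s.kill3TQ v a b c d x = true) : False := by
  unfold St.kill3TQ at hk
  simp only [Bool.and_eq_true, beq_iff_eq, bne_iff_ne, ne_eq, and_assoc] at hk
  obtain ⟨hdist, -, hstar, fva, fvb, fvc, fvd, fab, fbc, fcd, fda, -, fdx, fxa, fvx, -⟩ := hk
  obtain ⟨hlt, hnd⟩ := distinctLt_spec hdist
  have hv := hlt v (by simp); have ha := hlt a (by simp); have hb := hlt b (by simp)
  have hc := hlt c (by simp); have hd := hlt d (by simp); have hx := hlt x (by simp)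
  simp only [List.nodup_cons, List.mem_cons, not_or, List.not_mem_nil, not_false_eq_true,
    and_true, List.nodup_nil] at hnd
  obtain ⟨⟨hva, hvb, hvc, hvd, hvx⟩, ⟨hab, hac, had, hax⟩, ⟨hbc, hbd, hbx⟩, ⟨hcd, hcx⟩, hdx⟩ := hnd
  have B := fun p q (hp : p < 12) (hq : q < 12) (hpq : p ≠ q) (hf : s.ggb p q = 2) => h.flag2 p q hp hq hpq hf
  have N := fun p q (hp : p < 12) (hq : q < 12) (hpq : p ≠ q) (hf : s.ggb p q = 1) => h.flag1 p q hp hq hpq hf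
  refine M.noThreeTQ (φ v) (φ a) (φ b) (φ c) (φ d) (φ x) ?_ (B v a hv ha hva fva) (B v b hv hb hvb fvb)
    (B v c hv hc hvc fvc) (B v d hv hd hvd fvd) (B a b ha hb hab fab) (B b c hb hc hbc fbc) (B c d hc hd hcd fcd)
    (N d a hd ha (Ne.symm had) fda) (fun e => had (h.inj a d ha hd e.symm)) (B d x hd hx hdx fdx) (B x a hx ha (Ne.symm hax) fxa)
    (N v x hv hx hvx fvx) (fun e => hvx (h.inj v x hv hx e.symm))
  show M.star (φ v) = _
  rw [h.star_of_starIs hv hstar]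
  simp only [List.map_cons, List.map_nil, List.toFinset_cons, List.toFinset_nil, insert_empty_eq]
  rw [tset_sortTri12 hv ha hb hva hab hvb, tset_sortTri12 hv hb hc hvb hbc hvc, tset_sortTri12 hv hc hd hvc hcd hvd,
    tset_sortTri12 hv hd ha hvd (Ne.symm had) hva]

/-- **Certified `3T+2H` is a contradiction.** [folklore] -/
theorem kill3T2H_sound (h : RealizesB M φ s) {v a b c d x : ℕ} (hk : s.kill3T2H v a b c d x = true) : False := by
  unfold St.kill3T2H at hk
  simp only [Bool.and_eq_true, beq_iff_eq, bne_iff_ne, ne_eq, and_assoc] at hk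
  obtain ⟨hdist, -, hstar, fva, fvb, fvc, fvd, fab, fbc, fcd, fdx, fax, fvx, -⟩ := hk
  obtain ⟨hlt, hnd⟩ := distinctLt_spec hdist
  have hv := hlt v (by simp); have ha := hlt a (by simp); have hb := hlt b (by simp)
  have hc := hlt c (by simp); have hd := hlt d (by simp); have hx := hlt x (by simp)
  simp only [List.nodup_cons, List.mem_cons, not_or, List.not_mem_nil, not_false_eq_true,
    and_true, List.nodup_nil] at hnd
  obtain ⟨⟨hva, hvb, hvc, hvd, hvx⟩, ⟨hab, hac, had, hax⟩, ⟨hbc, hbd, hbx⟩, ⟨hcd, hcx⟩, hdx⟩ := hnd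
  have B := fun p q (hp : p < 12) (hq : q < 12) (hpq : p ≠ q) (hf : s.ggb p q = 2) => h.flag2 p q hp hq hpq hf
  have N := fun p q (hp : p < 12) (hq : q < 12) (hpq : p ≠ q) (hf : s.ggb p q = 1) => h.flag1 p q hp hq hpq hf
  refine M.noThreeTHH (φ v) (φ a) (φ b) (φ c) (φ d) (φ x) ?_ (B v a hv ha hva fva) (B v b hv hb hvb fvb)
    (B v c hv hc hvc fvc) (B v d hv hd hvd fvd) (B a b ha hb hab fab) (B b c hb hc hbc fbc) (B c d hc hd hcd fcd)
    (B d x hd hx hdx fdx) (B a x ha hx hax fax) (N v x hv hx hvx fvx) (fun e => hvx (h.inj v x hv hx e))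
  show M.star (φ v) = _
  rw [h.star_of_starIs hv hstar]
  simp only [List.map_cons, List.map_nil, List.toFinset_cons, List.toFinset_nil, insert_empty_eq]
  rw [tset_sortTri12 hv ha hb hva hab hvb, tset_sortTri12 hv hb hc hvb hbc hvc, tset_sortTri12 hv hc hd hvc hcd hvd,
    tset_sortTri12 hv hd hx hvd hdx hvx, tset_sortTri12 hv ha hx hva hax hvx]

/-- **`killAt` is a contradiction.** [folklore] -/
theorem killAt_sound (h : RealizesB M φ s) {v : ℕ} (hk : s.killAt v = true) : False := by
  unfold St.killAt at hk
  dsimp only at hk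
  by_cases h1 : (!s.isCl v) = true
  · rw [if_pos h1] at hk; exact Bool.false_ne_true hk
  rw [if_neg h1] at hk
  by_cases h2 : (s.linkCycle v).length = 4
  · rw [if_pos h2] at hk
    by_cases h3 : (!(s.linkCycle v).all fun u => s.ggb v u == 2) = true
    · rw [if_pos h3] at hk; exact Bool.false_ne_true hk
    rw [if_neg h3, List.any_eq_true] at hk
    obtain ⟨k, -, hk⟩ := hk
    split at hk
    · split at hk
      · exact h.kill4T_sound hk
      · split at hk
        · rw [List.any_eq_true] at hk
          obtain ⟨x, -, hx⟩ := hk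
          simp only [Bool.and_eq_true] at hx
          exact h.kill3TQ_sound hx.2
        · exact Bool.false_ne_true hk
    · exact Bool.false_ne_true hk
  · rw [if_neg h2] at hk
    by_cases h4 : (s.linkCycle v).length = 5
    · rw [if_pos h4, List.any_eq_true] at hk
      obtain ⟨k, -, hk⟩ := hk
      simp only [Bool.and_eq_true] at hk
      exact h.kill3T2H_sound hk.2
    · rw [if_neg h4] at hk; exact Bool.false_ne_true hk

/-! ### The final test -/

/-- A recorded bond 3-clique is placed. [folklore] -/
theorem cliqueNotPlaced_false (h : RealizesB M φ s) (hc : s.cliqueNotPlaced = true) : False := by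
  unfold St.cliqueNotPlaced at hc
  simp only [List.any_eq_true, List.mem_range, Bool.and_eq_true, decide_eq_true_eq, Bool.not_eq_true',
    and_assoc] at hc
  obtain ⟨a, ha, b, hb, c, hc, hab, hbc, fab, fbc, fac, hpl⟩ := hc
  unfold St.adjB at fab fbc fac
  simp only [Bool.and_eq_true, bne_iff_ne, ne_eq, beq_iff_eq] at fab fbc fac
  have B := fun p q (hp : p < 12) (hq : q < 12) (hpq : p ≠ q) (hf : s.ggb p q = 2) => h.flag2 p q hp hq hpq hf
  have hab' : a ≠ b := Nat.ne_of_lt hab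
  have hbc' : b ≠ c := Nat.ne_of_lt hbc
  have hac' : a ≠ c := Nat.ne_of_lt (lt_trans hab hbc)
  have hT := M.bond_tri (φ a) (φ b) (φ c) (fun e => hab' (h.inj a b ha hb e)) (fun e => hbc' (h.inj b c hb hc e))
    (fun e => hac' (h.inj a c ha hc e)) (B a b ha hb hab' fab.2) (B b c hb hc hbc' fbc.2) (B a c ha hc hac' fac.2)
  have := (placed_iff _ _ _ _).2 (h.placed_of_mem_tri ha hb hc hab' hbc' hac' hT)
  rw [this] at hpl
  exact Bool.noConfusion hpl

/-- **A verified bijection gives the conclusion.** [folklore] -/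
theorem concl_of_isoTo (h : RealizesB M φ s) (hall : s.allFlagged = true) {i : ℕ} (hi : i < 3) {perm : List ℕ}
    (hiso : s.isoTo i perm = true) : M.Concl := by
  classical
  unfold St.isoTo at hiso
  simp only [Bool.and_eq_true, beq_iff_eq, List.all_eq_true, List.mem_range, decide_eq_true_eq, Bool.or_eq_true,
    bne_iff_ne, ne_eq] at hiso
  obtain ⟨⟨⟨hlen, hlt⟩, hdist⟩, hadj⟩ := hiso
  have hlt' : ∀ k, k < 12 → perm.getD k 12 < 12 := by
    intro k hk
    have hm : perm.getD k 12 ∈ perm := by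
      rw [List.getD_eq_getElem?_getD, List.getElem?_eq_getElem (by rw [hlen]; exact hk)]
      exact List.getElem_mem _
    exact hlt _ hm
  -- the bijection perm
  let g : Fin 12 → Fin 12 := fun k => ⟨perm.getD k 12, hlt' k k.isLt⟩
  have ginj : Function.Injective g := by
    intro k l he
    simp only [g, Fin.mk.injEq] at he
    by_contra hne
    have hne' : (k : ℕ) ≠ l := fun e => hne (Fin.ext e)
    rcases hdist k k.isLt l l.isLt with e | e
    · exact hne' e
    · exact e he
  -- the labelling as a bijection
  let Φ : Fin 12 → Fin 12 := fun k => φ k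
  have Φinj : Function.Injective Φ := by
    intro k l he
    exact Fin.ext (h.inj k l k.isLt l.isLt he)
  let σ : Equiv.Perm (Fin 12) :=
    (Equiv.ofBijective g (Finite.injective_iff_bijective.1 ginj)).trans (Equiv.ofBijective Φ (Finite.injective_iff_bijective.1 Φinj))
  have hσ : ∀ k : Fin 12, σ k = φ (perm.getD k 12) := fun k => rfl
  refine ⟨σ, i, hi, fun v w hvw => ?_⟩
  rw [hσ, hσ]
  have hpv := hlt' v v.isLt
  have hpw := hlt' w w.isLt
  have hne : perm.getD v 12 ≠ perm.getD w 12 := by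
    rcases hdist v v.isLt w w.isLt with e | e
    · exact absurd (Fin.ext e) hvw
    · exact e
  have hA := hadj v v.isLt w w.isLt
  unfold St.adjB at hA
  -- bond ↔ flag 2 ↔ adjB ↔ pattern
  constructor
  · intro hb
    have hf : s.ggb (perm.getD v 12) (perm.getD w 12) = 2 := by
      have hle := h.flag_le (perm.getD v 12) (perm.getD w 12)
      have h0 : s.ggb (perm.getD v 12) (perm.getD w 12) ≠ 0 := by
        unfold St.allFlagged at hall
        simp only [List.all_eq_true, List.mem_range, Bool.or_eq_true, beq_iff_eq, bne_iff_ne, ne_eq] at hall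
        rcases hall _ hpv _ hpw with e | e
        · exact absurd e hne
        · exact e
      have h1 : s.ggb (perm.getD v 12) (perm.getD w 12) ≠ 1 := fun e => by
        have := h.flag1 _ _ hpv hpw hne e
        rw [hb] at this; exact Bool.noConfusion this
      omega
    rw [← hA]
    simp only [Bool.and_eq_true, bne_iff_ne, ne_eq, beq_iff_eq]
    exact ⟨hne, hf⟩
  · intro hp
    rw [← hA] at hp
    simp only [Bool.and_eq_true, bne_iff_ne, ne_eq, beq_iff_eq] at hp
    exact h.flag2 _ _ hpv hpw hne hp.2

/-- **The final test is sound.** [folklore] -/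
theorem final_sound (h : RealizesB M φ s) (hf : s.final = true) : M.Concl := by
  unfold St.final at hf
  split_ifs at hf with h1 h2
  · exact (h.cliqueNotPlaced_false h1).elim
  · rw [List.any_eq_true] at h2
    obtain ⟨v, -, hv⟩ := h2
    exact (h.killAt_sound hv).elim
  · rw [Bool.and_eq_true] at hf
    obtain ⟨hall, hacc⟩ := hf
    unfold St.accept at hacc
    rw [List.any_eq_true] at hacc
    obtain ⟨i, hi, hiso⟩ := hacc
    have hi3 : i < 3 := by simpa using hi
    split at hiso
    · rename_i p hp
      exact h.concl_of_isoTo hall hi3 hiso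
    · exact Bool.noConfusion hiso

/-! ### The Phase-2 driver -/

/-- Sublists of the right length are enumerated by `choose`. [folklore] -/
theorem mem_choose : ∀ (l l' : List ℕ), l'.Sublist l → l' ∈ choose l l'.length := by
  intro l
  induction l with
  | nil => intro l' hs; rw [List.sublist_nil.1 hs]; simp [choose]
  | cons x xs ih =>
    intro l' hs
    cases hs with
    | cons _ hs' =>
      have := ih _ hs'
      cases l' with
      | nil => simp [choose]
      | cons y ys => simp only [choose, List.length_cons, List.mem_append]; exact Or.inr this
    | cons_cons _ hs' =>
      have := ih _ hs'
      simp only [choose, List.length_cons, List.mem_append, List.mem_map]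
      exact Or.inl ⟨_, this, rfl⟩

/-- The true bond partners of `v` in its link: four of them. [folklore] -/
theorem length_bondLink (h : RealizesB M φ s) {v : ℕ} (hv : v < 12) :
    ((s.link v).filter fun u => M.bond (φ v) (φ u)).length = 4 := by
  classical
  set Lb := (s.link v).filter fun u => M.bond (φ v) (φ u) with hLb
  have hndL : (s.link v).Nodup := (List.nodup_range).filter _
  have hnd : Lb.Nodup := hndL.filter _
  have hmem : ∀ u, u ∈ Lb ↔ u ∈ s.link v ∧ M.bond (φ v) (φ u) = true := fun u => by rw [hLb, List.mem_filter]
  apply le_antisymm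
  · -- injects into the partners
    have hinj : Set.InjOn φ (Lb.toFinset : Set ℕ) := by
      intro a ha b hb he
      have ha' := ((hmem a).1 (by simpa using ha)).1
      have hb' := ((hmem b).1 (by simpa using hb)).1
      rw [mem_link, h.n_eq] at ha' hb'
      exact h.inj a b ha'.1 hb'.1 he
    have hsub : Lb.toFinset.image φ ⊆ M.partners (φ v) := by
      intro w hw
      rw [mem_image] at hw
      obtain ⟨u, hu, rfl⟩ := hw
      exact CF.mem_partners.2 ((hmem u).1 (by simpa using hu)).2
    have := card_le_card hsub
    rwa [card_image_of_injOn hinj, List.toFinset_card_of_nodup hnd, CF.card_partners] at this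
  · -- the partners are images of link labels
    have hsub : M.partners (φ v) ⊆ Lb.toFinset.image φ := by
      intro w hw
      obtain ⟨u, hu, rfl⟩ := h.exists_link_of_bond hv (CF.mem_partners.1 hw)
      rw [mem_image]
      exact ⟨u, by simpa using (hmem u).2 ⟨hu, CF.mem_partners.1 hw⟩, rfl⟩
    have := card_le_card hsub
    rw [CF.card_partners] at this
    exact le_trans this (le_trans card_image_le (List.toFinset_card_le _))

/-- **Phase 2 is sound**: if `assign` returns `true` on a realized state, the frame has the
conclusion. [folklore] -/
theorem assign_sound : ∀ (fuel v : ℕ) (s : St), RealizesB M φ s → s.assign v fuel = true → M.Concl := by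
  intro fuel
  induction fuel with
  | zero => intro v s _ h; simp [St.assign] at h
  | succ fuel ih =>
    intro v s h hA
    unfold St.assign at hA
    dsimp only at hA
    have hlink : ∀ u, u ∈ s.link v → u < 12 ∧ u ≠ v := fun u hu => by
      have := (mem_link s v u).1 hu
      rw [h.n_eq] at this; exact ⟨this.1, this.2.1⟩
    split_ifs at hA with hv12 hmust
    · exact h.final_sound hA
    · -- more than four recorded partners: impossible
      exfalso
      have hv : v < 12 := Nat.not_le.1 hv12
      have hle : ((s.link v).filter fun u => s.ggb v u == 2).length ≤ 4 := by
        apply h.length_le_four hv (((List.nodup_range).filter _).filter _)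
        intro x hx
        rw [List.mem_filter] at hx
        obtain ⟨hx12, hxv⟩ := hlink x hx.1
        exact ⟨hx12, hxv, by simpa using hx.2⟩
      exact absurd hmust (Nat.not_lt.2 hle)
    · have hv : v < 12 := Nat.not_le.1 hv12
      rw [List.all_eq_true] at hA
      classical
      -- the true choice
      set must := (s.link v).filter fun u => s.ggb v u == 2 with hmust'
      set free := (s.link v).filter fun u => s.ggb v u == 0 with hfree
      set ch := free.filter fun u => M.bond (φ v) (φ u) with hch
      -- lengths: |bond partners in link| = |must| + |ch| = 4
      have hsplit : ((s.link v).filter fun u => M.bond (φ v) (φ u)).length = must.length + ch.length := by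
        have e1 : must = ((s.link v).filter fun u => M.bond (φ v) (φ u)).filter fun u => s.ggb v u == 2 := by
          rw [hmust', List.filter_filter]
          apply List.filter_congr
          intro u hu
          obtain ⟨hu12, huv⟩ := hlink u hu
          by_cases hf : s.ggb v u = 2
          · simp [hf, h.flag2 v u hv hu12 (Ne.symm huv) hf]
          · simp [hf]
        have e2 : ch = ((s.link v).filter fun u => M.bond (φ v) (φ u)).filter fun u => !(s.ggb v u == 2) := by
          rw [hch, hfree, List.filter_filter, List.filter_filter]
          apply List.filter_congr
          intro u hu
          obtain ⟨hu12, huv⟩ := hlink u hu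
          have hle := h.flag_le v u
          by_cases hb : M.bond (φ v) (φ u) = true
          · have h1 : s.ggb v u ≠ 1 := fun e => by
              have := h.flag1 v u hv hu12 (Ne.symm huv) e; rw [hb] at this; exact Bool.noConfusion this
            by_cases h0 : s.ggb v u = 0
            · simp [hb, h0]
            · have : s.ggb v u = 2 := by omega
              simp [hb, this]
          · simp [hb]
        rw [e1, e2]
        exact List.length_eq_length_filter_add _
      have h4 := h.length_bondLink hv
      have hlen : ch.length = 4 - must.length := by omega
      have hchmem : ch ∈ choose free (4 - must.length) := by
        rw [← hlen]; exact mem_choose free ch (by rw [hch]; exact List.filter_sublist)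
      have hbody := hA ch hchmem
      -- B = must ++ ch is the true partner set
      have hBm : ∀ u ∈ must ++ ch, u < 12 ∧ u ≠ v ∧ M.bond (φ v) (φ u) = true := by
        intro u hu
        rw [List.mem_append] at hu
        rcases hu with hu | hu
        · rw [hmust', List.mem_filter] at hu
          obtain ⟨hu12, huv⟩ := hlink u hu.1
          exact ⟨hu12, huv, h.flag2 v u hv hu12 (Ne.symm huv) (by simpa using hu.2)⟩
        · rw [hch, List.mem_filter, hfree, List.mem_filter] at hu
          obtain ⟨hu12, huv⟩ := hlink u hu.1.1
          exact ⟨hu12, huv, by simpa using hu.2⟩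
      have hBc : ∀ u, u < 12 → u ≠ v → M.bond (φ v) (φ u) = true → u ∈ must ++ ch := by
        intro u hu12 huv hb
        obtain ⟨u', hu', he⟩ := h.exists_link_of_bond hv hb
        obtain ⟨hu'12, -⟩ := hlink u' hu'
        have : u' = u := h.inj u' u hu'12 hu12 he
        subst this
        rw [List.mem_append]
        have hle := h.flag_le v u'
        have h1 : s.ggb v u' ≠ 1 := fun e => by
          have := h.flag1 v u' hv hu'12 (Ne.symm huv) e; rw [hb] at this; exact Bool.noConfusion this
        by_cases h2 : s.ggb v u' = 2
        · left; rw [hmust', List.mem_filter]; exact ⟨hu', by simpa using h2⟩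
        · right
          have h0 : s.ggb v u' = 0 := by omega
          rw [hch, List.mem_filter, hfree, List.mem_filter]
          exact ⟨⟨hu', by simpa using h0⟩, by simpa using hb⟩
      obtain ⟨s', hs', hR', -⟩ := assignWith_sound h hv hBm hBc
      rw [hs'] at hbody
      simp only [] at hbody
      split_ifs at hbody with hkill
      · rw [List.any_eq_true] at hkill
        obtain ⟨u, -, hu⟩ := hkill
        exact (hR'.killAt_sound hu).elim
      · exact ih (v + 1) s' hR' hbody

end RealizesB

/-- **Phase 2 on a closed-up realized leaf is sound.** [folklore] -/
theorem bondPhase_sound {M : CF} {φ : ℕ → Fin 12} {s : St} (h : Realizes M φ s) (hnone : s.chooseOpen = none)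
    (hb : s.bondPhase = true) : M.Concl :=
  RealizesB.assign_sound 13 0 _ (initFlags_sound h hnone) hb

end ShellCensusSearch

end Literature.Geometry.DiscreteGeometry
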